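import Summits.CriticalPhenomena.CardyFormulaZ2.Theses.CardyViaSLE6
import Summits.CriticalPhenomena.CardyFormulaZ2.Theses.CardySelfRefinement
import Summits.CriticalPhenomena.CardyFormulaZ2.Theorems.CardySelfRefinementLagHandOffDiscretisable
import Literature.Probability.RandomPlanarGeometry.ConformalRestrictionCovariance
import Literature.Probability.LatticeModels.MedialInterfaceMeasurability

/-!
# Line `euclid-to-conformal` for the piece `LimitFamilyConformalCovariance` (child X₂ of crux r2
`ConformalCovarianceOfSubseqLimits`, stmt-CriticalPhenomena-0763, route CardyViaSLE6)

`LimitFamilyConformalCovariance`: IF a chordal family `P` of probability laws is the full scaling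
limit of the bond-ℤ² exploration interfaces (every Dobrushin domain, every admissible
ℤ²-discretisation family, weak convergence along `δ → 0⁺`), THEN `P` is conformally covariant
(`ChordalFamily.IsConformallyCovariant`).  This is the SYMMETRY half of Beffara's dichotomy
(arXiv:0708.3908, Prop. 4: an argument blind to the embedding proves existence-type statements for
every sheared lattice at once, but conformal covariance for at most one shear) — so the line must
visibly use the two embedding-specific inputs available on ℤ²: the order-4 symmetry / DKKMO rotation
invariance, and the exact lattice domain Markov property + locality of the exploration.

Skeleton (3 registered stubs):
* `stub_similarityCovariance` — the full limit is covariant under all similarities `z ↦ c z + w`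
  (dilations: exact lattice scaling `δℤ² ∩ rΩ = r(δ/r ℤ² ∩ Ω)` + E-blindness of the hypothesis;
  translations: lattice translations exact + stability under `O(δ)` domain perturbations (RSW
  boundary arms); rotations: DKKMO 2020 Thm 1.2 (`dkkmo_rotation_invariance`) transferred from the
  loop ensemble to Dobrushin interfaces) — XL because of the rotation transfer;
* `stub_localMarkov` — the full limit is chordal, domain-Markov, local, target-independent in the
  tree's typed sense and a.s. traces no boundary arc (limit passage of properties EXACT on the
  lattice; RSW regularity) — XL, shared in content with CardySelfRefinement's `LagHandOff` (ii);
* `stub_upgrade` — the heart: a similarity-covariant local Markov chordal family that IS the full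
  ℤ² percolation limit is conformally covariant ("Euclidean + Markov + locality ⇒ conformal" for
  the percolation-pinned family).  It is IMPLIED by the sister crux `CardySelfRefinement.SymmetryUpgradeR`
  (stmt-CriticalPhenomena-17239, a live lead with registered lines) + `stub_discretisable` +
  `ChordalFamily.isConformallyCovariant_of_isSLELaw` — PROVED below (`stub_upgrade_of_symmetryUpgradeR`),
  so the piece has a plan on record; and it is WEAKER (covariance, not SLE₆ — the identification
  is route CardyViaSLE6's own r5 `CovariantLimitIsSLE6`).

Composition `LimitFamilyConformalCovariance_of`: pure logic (bundle the two structural stubs into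
`IsLocalMarkovChordalFamily`, feed the upgrade).  No sorry outside the three stubs.
-/

noncomputable section

open Filter Topology MeasureTheory Set
open scoped BoundedContinuousFunction unitInterval
open Literature.Probability.RandomPlanarGeometry Literature.Probability.LatticeModels
open Literature.Probability.Percolation (bondPercolation half BondConfig)
open Summit.CriticalPhenomena.CardyFormulaZ2.Theses.CardyViaSLE6

namespace Summit.CriticalPhenomena.CardyFormulaZ2.Cruxes.LimitFamilyConformalCovariance.EuclidToConformal

/-- The piece X₂ (verbatim the child statement `LimitFamilyConformalCovariance` of the split of
`ConformalCovarianceOfSubseqLimits`; inlined here until the gate writes the route decl). -/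
def LimitFamilyConformalCovariance : Prop :=
  ∀ P : Literature.Probability.RandomPlanarGeometry.ChordalFamily, (∀ D, MeasureTheory.IsProbabilityMeasure (P D)) → (∀ (D : Literature.Probability.RandomPlanarGeometry.DobrushinDomain) (E : ℝ → Literature.Probability.LatticeModels.DiscreteDobrushin), Literature.Probability.LatticeModels.ZdDiscretisationFamily D E → ∀ f : BoundedContinuousFunction (Literature.Probability.RandomPlanarGeometry.CurveClass ℂ) ℝ, Filter.Tendsto (fun δ => ∫ ω, f (Literature.Probability.Percolation.bondInterfaceIn D (E δ) ω) ∂(Literature.Probability.Percolation.bondPercolation (Literature.Probability.LatticeModels.zdGraph 2) Literature.Probability.Percolation.half)) (nhdsWithin 0 (Set.Ioi 0)) (nhds (∫ γ, f γ ∂(P D)))) → P.IsConformallyCovariant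

/-- `P` is the FULL scaling limit of the bond-ℤ² interfaces (the hypothesis of the piece). -/
def IsFullLimit (P : ChordalFamily) : Prop :=
  ∀ (D : DobrushinDomain) (E : ℝ → DiscreteDobrushin), ZdDiscretisationFamily D E →
    ∀ f : CurveClass ℂ →ᵇ ℝ, Tendsto (fun δ => ∫ ω, f (Literature.Probability.Percolation.bondInterfaceIn D (E δ) ω)
      ∂(bondPercolation (zdGraph 2) half)) (𝓝[>] 0) (𝓝 (∫ γ, f γ ∂(P D)))

/-- `P`-a.s. no non-trivial sub-arc of the curve lies in `∂D` (verbatim the non-tracing clause of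
`CardySelfRefinement.SymmetryUpgradeR`). -/
def NoBoundaryTracing (P : ChordalFamily) : Prop :=
  ∀ D : DobrushinDomain, ∀ᵐ γ ∂(P D), ∀ c : Curve ℂ, CurveClass.mk c = γ →
    ∀ s t : I, s < t → c '' Set.Icc s t ⊆ frontier D.carrier → (c '' Set.Icc s t).Subsingleton

/-! ### Registered stubs -/

/-- STUB (XL) — **Euclidean covariance of the full limit.** Dilations: exact lattice scaling plus
the E-blindness built into `IsFullLimit` (M, provable now up to the equivariance bookkeeping of
`meshDomain` / `medialExplorationCurve`); translations: exact for lattice vectors, general vectors by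
stability of the limit under `O(δ)` perturbations of the Dobrushin data (RSW half-plane arms, L);
rotations: DKKMO 2020 Thm 1.2 / `Literature.Probability.Percolation.dkkmo_rotation_invariance`
transferred from loops to Dobrushin interfaces (XL; = CardyRotToConf `LoopRotation` + the transfer
inside `LimitFamily`).  Why it might fail: only as typed — the loop→interface transfer at rough
marked prime ends. -/
theorem stub_similarityCovariance :
    ∀ P : ChordalFamily, (∀ D, IsProbabilityMeasure (P D)) → IsFullLimit P →
      P.IsSimilarityCovariant := by
  sorry

/-- STUB (XL) — **the full limit is a non-tracing local Markov chordal family** in the tree's typed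
sense (`IsChordal`, `IsDomainMarkov`, `IsLocal`, `IsTargetIndependent`, `NoBoundaryTracing`): limit
passage of the domain Markov property, locality and target independence, which are EXACT identities
of the lattice exploration at every mesh, plus RSW regularity (half-annulus circuits of both colours:
no boundary tracing, endpoints at the marks).  Shared in content with `CardySelfRefinement.LagHandOff`
(ii) (landed partial work: `Theorems/CardySelfRefinementLagHandOffLimitMarkov`, `…LocalityPassage`,
`…NoTrace*`).  Why it might fail: the set-based `IsMarkovExtension.domain` clause (prime-end caveat)
and slit-domain equicontinuity uniform in `δ` (Camia–Newman 2007 Rem. 7.1). -/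
theorem stub_localMarkov :
    ∀ P : ChordalFamily, (∀ D, IsProbabilityMeasure (P D)) → IsFullLimit P →
      P.IsChordal ∧ P.IsDomainMarkov ∧ P.IsLocal ∧ P.IsTargetIndependent ∧ NoBoundaryTracing P := by
  sorry

/-- STUB (open; the HARDEST) — **Euclidean + Markov + locality ⇒ conformal, for the
percolation-pinned family**: a similarity-covariant, domain-Markov, local, target-independent,
non-tracing chordal family which IS the full scaling limit of the bond-ℤ² interfaces is conformally
covariant.  No model-blind version can hold (`Literature.Barriers.CriticalPhenomena.EmbeddingModulusUniqueness`;
the pure axiomatic form without pinning is REFUTED, negatives stmt-CriticalPhenomena-0698), so a proof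
must use the pinning `IsFullLimit P`.  Implied by the sister crux `CardySelfRefinement.SymmetryUpgradeR`
(`stub_upgrade_of_symmetryUpgradeR` below, proved); weaker than it (covariance, not SLE₆). -/
theorem stub_upgrade :
    ∀ P : ChordalFamily, (∀ D, IsProbabilityMeasure (P D)) → IsFullLimit P →
      IsLocalMarkovChordalFamily P → NoBoundaryTracing P → P.IsConformallyCovariant := by
  sorry

/-! ### Composition (real proof) -/

/-- **Composition.** The three stubs give the piece. -/
theorem LimitFamilyConformalCovariance_of
    (h₁ : ∀ P : ChordalFamily, (∀ D, IsProbabilityMeasure (P D)) → IsFullLimit P →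
      P.IsSimilarityCovariant)
    (h₂ : ∀ P : ChordalFamily, (∀ D, IsProbabilityMeasure (P D)) → IsFullLimit P →
      P.IsChordal ∧ P.IsDomainMarkov ∧ P.IsLocal ∧ P.IsTargetIndependent ∧ NoBoundaryTracing P)
    (h₃ : ∀ P : ChordalFamily, (∀ D, IsProbabilityMeasure (P D)) → IsFullLimit P →
      IsLocalMarkovChordalFamily P → NoBoundaryTracing P → P.IsConformallyCovariant) :
    LimitFamilyConformalCovariance := by
  intro P hprob hlim
  have hfull : IsFullLimit P := hlim
  obtain ⟨hch, hmk, hloc, hti, hnt⟩ := h₂ P hprob hfull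
  exact h₃ P hprob hfull ⟨hch, h₁ P hprob hfull, hmk, hloc, hti⟩ hnt

/-- The piece, from the registered stubs. -/
theorem limitFamilyConformalCovariance : LimitFamilyConformalCovariance :=
  LimitFamilyConformalCovariance_of stub_similarityCovariance stub_localMarkov stub_upgrade

/-! ### The plan on record for the hardest stub: it follows from the sister crux
`CardySelfRefinement.SymmetryUpgradeR` (stmt-CriticalPhenomena-17239) — proved reduction. -/

/-- The interface map of any discrete Dobrushin data is measurable (`measurable_of_medialExploration`). -/
theorem measurable_bondInterfaceIn (D : DobrushinDomain) (E : DiscreteDobrushin) :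
    Measurable (Literature.Probability.Percolation.bondInterfaceIn D E) :=
  measurable_of_medialExploration E fun ω ω' h => by
    simp only [Literature.Probability.Percolation.bondInterfaceIn, medialExplorationCurve_congr h]

/-- **`SymmetryUpgradeR ⇒ stub_upgrade`** (so the hardest stub is covered by a live sister line):
a full limit is in particular a sequential limit along `δs n = 1/(n+1)` (clause (iv) of
`SymmetryUpgradeR`), interfaces are measurable, every Dobrushin domain is admissibly discretisable
(`HittingTournament.stub_discretisable`), so `SymmetryUpgradeR` makes `P D` the chordal SLE₆ law of
every `D`, and a family of SLE₆ laws is conformally covariant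
(`ChordalFamily.isConformallyCovariant_of_isSLELaw`, Lawler 2005 §6.1). -/
theorem stub_upgrade_of_symmetryUpgradeR
    (hSU : Summit.CriticalPhenomena.CardyFormulaZ2.Theses.CardySelfRefinement.SymmetryUpgradeR) :
    ∀ P : ChordalFamily, (∀ D, IsProbabilityMeasure (P D)) → IsFullLimit P →
      IsLocalMarkovChordalFamily P → NoBoundaryTracing P → P.IsConformallyCovariant := by
  intro P _ hfull hLM hNT
  -- the mesh sequence 1/(n+1)
  have hs₀' : Tendsto (fun n : ℕ => 1 / ((n : ℝ) + 1)) atTop (𝓝[>] (0 : ℝ)) :=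
    tendsto_nhdsWithin_iff.2 ⟨tendsto_one_div_add_atTop_nhds_zero_nat,
      Eventually.of_forall fun n => Set.mem_Ioi.2 Nat.one_div_pos_of_nat⟩
  have hmeas : ∀ (D : DobrushinDomain) (E : ℝ → DiscreteDobrushin), ZdDiscretisationFamily D E →
      ∀ᶠ δ in 𝓝[>] (0 : ℝ), AEMeasurable (Literature.Probability.Percolation.bondInterfaceIn D (E δ))
        (bondPercolation (zdGraph 2) half) :=
    fun D E _ => Eventually.of_forall fun δ => (measurable_bondInterfaceIn D (E δ)).aemeasurable
  have hiv : ∃ δs : ℕ → ℝ, (∀ n, 0 < δs n) ∧ Tendsto δs atTop (𝓝 0) ∧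
      ∀ (D : DobrushinDomain) (E : ℝ → DiscreteDobrushin), ZdDiscretisationFamily D E →
        ∀ f : CurveClass ℂ →ᵇ ℝ, Tendsto (fun n => ∫ ω,
          f (Literature.Probability.Percolation.bondInterfaceIn D (E (δs n)) ω)
            ∂(bondPercolation (zdGraph 2) half)) atTop (𝓝 (∫ γ, f γ ∂(P D))) :=
    ⟨fun n => 1 / ((n : ℝ) + 1), fun n => Nat.one_div_pos_of_nat,
      tendsto_one_div_add_atTop_nhds_zero_nat, fun D E hE f => (hfull D E hE f).comp hs₀'⟩
  have hSLE : ∀ D : DobrushinDomain, IsSLELaw 6 D (P D) := fun D => by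
    obtain ⟨E, hE⟩ :=
      Summit.CriticalPhenomena.CardyFormulaZ2.Cruxes.LagHandOff.HittingTournament.stub_discretisable D
    exact hSU P hLM hNT hmeas hiv D E hE
  exact ChordalFamily.isConformallyCovariant_of_isSLELaw hSLE

end Summit.CriticalPhenomena.CardyFormulaZ2.Cruxes.LimitFamilyConformalCovariance.EuclidToConformal
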